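import Literature.MathematicalPhysics.QuantumFieldTheory.Balaban1983to89.B4Lemma22PertVSup
import Literature.MathematicalPhysics.QuantumFieldTheory.Balaban1983to89.B4PartitionUnity22

/-!
# [B4] p. 575: THE CUBE CONFIGURATIONS `Ã_j = A₀ + θ_jA′` OF A (1.7)-REGULAR FIELD — construction on the lattice regions
# of the lineage, agreement with `A` on the ¾-core, constancy near `∂□_j`, and the sizes «|A′|, |∂^η_μA′| ≤ c′e^{β−1}»
# PROVED from (1.7) [Balaban1983RegularityDecay]

statement-level skeleton of published theorems with citation tags; proofs where landed; nothing here is a claim about the Yang–Mills mass gap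

CITATION HEADER.  T. Bałaban, *Regularity and decay of lattice Green's functions*, Commun. Math. Phys. **89** (1983)
571–597, doi:10.1007/bf01214744 [Balaban1983RegularityDecay] (cell paper B4; held text
`paper:balaban1983-cmp89-regularity-decay`, journal page = PDF page + 570; pp. 572–573, 575, 577–579, 581).  PDF held:
yes.  Unit `lit-balaban-p35` gen 6 (Phase-2 proof seat), HOME `run/shared/lean/pub/lit-balaban/`.  WHAT IS REPRODUCED: SKELETON
rows **B4.Def§2** / **B4.Eq2.2** (the configurations `Ã_j` entering `G₀ = Σ_j h_jG_k(□_j,Ã_j)h_j` (2.2)) and the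
hypotheses of **B4.Lem2.2** («Ã … a regular vector field configuration … constant in a neighbourhood of the boundary of
□»), for a field that is ONLY assumed regular in the printed sense (1.7).  File 1 of 3 (companions:
`B4CubeFieldHyps22` — the Lemma-2.2-lineage field hypotheses at `Ã_j` and the threshold «e sufficiently small»;
`B4Eq220CubeField` — the per-cube factor bounds (2.20)/(2.21)/c₁ of the walk expansion at `Ã_j`).  Imports
`B4Lemma22PertVSup` (for `constBond_antisymm`; closure: `B4GaugeCovariance.constBond`, `B4Lower18Regular(Region)`
staircases and `compField`, `B4Lemma21Region.compField_rev`) and r01's `B4PartitionUnity22` (`thetaCube`, `thetaProf`,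
`D1`, `abs_thetaCube_diff_le`).

WHAT IS PRINTED (p. 575, verbatim).  «… where the configurations Ã_j are constructed in the following way: if □_j
intersects the boundary of Ω, then Ã_j = A; if □_j is an interior cube of Ω, then we take Ã_j as equal to A on the cube
{x: |x − Mj| ≤ ¾M}, and changing regularly to a constant function in a neighbourhood of a boundary of □_j. For example
using the regularity condition (1.4) [= (1.7)] we can write the configuration A on □_j as A = A₀ + A′, where A₀ is a
constant configuration, e.g. A₀ = A(Mj), and A′ is regular and small, i.e. |A′|, |∂^η_μA′| ≤ c′e^{β−1}, with c′
depending on c, d, and M, more exactly c′ = dMc. We take a function θ ∈ C₀^∞(]−1,1[), θ = 1 on [−¾,¾], and we define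
θ_j(x) = Π_{μ=1}^d θ((x_μ − Mj_μ)/M), Ã_j = A₀ + θ_jA′. In the sequel we will use this definition of Ã_j. Of course it
satisfies the regularity condition (1.4) with another constant c.»; p. 573 (1.7): «|(∂^η_μA)(x)| ≤ ce^{β−1}, x ∈ Ω,
μ = 1,…,d, β > 0».

DICTIONARY (lattice units, as in the lineage: `d ↦ d + 1` lattice dimensions; fine box `□ = Π_μ[0, nM_μ)` of mesh
`η = 1/n`, `n = L^k`, `L = ℓ + 1 ≥ 2`; the print's large-cube size `M` is `K` (unit blocks); `A_ν(x)` in component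
form on `ℤ^{d+1}` (`Ac`), bond function `compField Ac`; charge `κ = eη = e/n`; (1.7) in the b04/p17 reading
`|A_ν(x + e_μ) − A_ν(x)| ≤ c e^{β−1}/n` on `□`).
* `thetaZ n K j x = θ_j(x/n)` — r01's `thetaCube` read on the fine lattice (`= 1` on the ¾-core, `= 0` beyond ⅞).
* `A₀ = Ac 0` — the constant configuration sampled at the base corner of `□` (the print's «e.g. A₀ = A(Mj)»; any
  point of `□_j` serves, the corner keeps the lineage's up-going staircases; `c′` changes by a factor `≤ 2`).
* `fluct R A₀ Ac` = `A′ = A − A₀` as a bond function on the region `R`; `cubeFluct R n K j A₀ Ac` = `θ_jA′` with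
  `θ_j` read at the lower end point `x ⊓ y` of the bond (so `(θ_jA′)_{⟨x,x+e_μ⟩} = θ_j(x)A′_μ(x)`, the component
  form of the print, and the bond function stays antisymmetric); `cubeField R n K j A₀ Ac = A₀ + θ_jA′ = Ã_j`.

WHAT THIS MODULE PROVES (all in full; no `sorry`, standard axioms).
* §1 `thetaZ`: `thetaZ_mem_Icc`, `abs_thetaZ_le_one`, **`thetaZ_eq_one`** (¾-core: `4|x_μ − nKj_μ| ≤ 3nK`),
  **`thetaZ_eq_zero`** (`8|x_μ − nKj_μ| ≥ 7nK` for one `μ`), **`abs_thetaZ_step_le`** (`|θ_j(x + e_μ) − θ_j(x)| ≤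
  D1(θ)/(nK)`).
* §2 the fields on an arbitrary region `R`: `fluct_antisymm`, `cubeFluct_antisymm`, `cubeField_antisymm`
  («A_b̄ = −A_b»), the bond values `fluct_step`/`cubeFluct_step`/`cubeField_step`,
  **`cubeField_eq_compField`** («equal to A on the cube {x: |x − Mj| ≤ ¾M}»), **`cubeField_eq_constBond`**
  («changing regularly to a constant function in a neighbourhood of a boundary of □_j»).
* §3 THE SIZES FROM (1.7) on a box `Π_μ[0, N_μ)`, `N_μ ≤ T`, forward differences of `A` bounded by `δ`:
  **`abs_comp_sub_corner_le`** ((1.7) ⇒ «A = A₀ + A′, |A′| ≤ c′e^{β−1}»: `|A_ν(x) − A_ν(0)| ≤ (d+1)Tδ`, telescoping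
  along the staircase from the corner), `abs_fluct_le`, `abs_cubeFluct_le` (`|θ_jA′_b| ≤ (d+1)Tδ`),
  **`abs_cubeFluct_sub_le`** (the `|∂A′|`-member on consecutive parallel bonds: `≤ δ(1 + D1(θ)(d+1)T/(nK))` —
  «it satisfies the regularity condition with another constant»), `cubeFluct_sub_rev`,
  `thetaZ_eq_zero_of_face` / **`cubeFluct_eq_zero_of_face`** (`θ_jA′ = 0` on the bonds at the faces of the box that
  contains the cube: `nK(j_μ + 1) ≤ N_μ`, `j_μ ≥ 1`, `nK ≥ 16`).
* §3b (v1.1, append-only) the component form `cubeComp` of `Ã_j` (`(Ã_j)_ν(x) = A₀,ν + θ_j(x)(A_ν(x) − A₀,ν)`;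
  `compField_cubeComp`: its bond function on any region is `cubeField`) and **`cubeComp_regular`** — «Of course it
  satisfies the regularity condition (1.4) with another constant c»: (1.7) for `A` with bound `δ` on `□` ⇒ (1.7) for
  `Ã_j` on the bonds of `□` with bound `δ(1 + D1(θ)(d+1)T/(nK))`, every pair of directions (transverse shifts included).

HONEST SCOPE.  (i) The cube `□_j` is presented inside the lineage's origin-anchored box with the label `j` placed in it
(the print's `□_j` is `N_μ = 2nK`, `j_μ = 1` after a translation).  (ii) (1.7) is read with the forward difference on the
box (b04 (D4)); `A₀` is sampled at the corner (print: «e.g. A₀ = A(Mj)»).  (iii) Nothing operator-theoretic here (files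
2–3).  Definitions with bodies and theorems only; no `Prop` fact, no `sorry`; axioms standard.
-/

namespace Literature.MathematicalPhysics.QuantumFieldTheory.Balaban1983to89.B4CubeFields22

open Finset Matrix
open Literature.MathematicalPhysics.QuantumFieldTheory.Balaban1983to89.B4GaugeCovariance
open Literature.MathematicalPhysics.QuantumFieldTheory.Balaban1983to89.B4Reflection242 (boxDom nbrs mem_boxDom mem_nbrs)
open Literature.MathematicalPhysics.QuantumFieldTheory.Balaban1983to89.B4Lower18Regular (e1 e1_apply_self e1_apply_ne
  stair pathEnd_stair length_stair_le mem_stair mem_boxDom_of_between)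
open Literature.MathematicalPhysics.QuantumFieldTheory.Balaban1983to89.B4Lower18RegularRegion (compField compField_add
  compField_sub constBond_step constBond_step_rev pathRel_stairL_up pathRel_and pathRel_chain abs_sub_le_of_pathRel)
open Literature.MathematicalPhysics.QuantumFieldTheory.Balaban1983to89.B4Lemma21Region (compField_rev)
open Literature.MathematicalPhysics.QuantumFieldTheory.Balaban1983to89.B4Lemma22PertVSup (constBond_antisymm)
open Literature.MathematicalPhysics.QuantumFieldTheory.Balaban1983to89.B4PartitionUnity22 (thetaProf thetaCube
  D1 D1_nonneg contDiff_thetaProf hasCompactSupport_thetaProf thetaCube_mem_Icc thetaCube_eq_one thetaCube_eq_zero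
  abs_thetaCube_diff_le)

noncomputable section

variable {d : ℕ}

/-! ## §1. `θ_j` on the fine lattice -/

section Theta

/-- **`θ_j` read on the fine lattice** `ℤ^{d+1}` of mesh `1/n` (large-cube size `K`, label `j`):
`thetaZ n K j x = θ_j(x/n) = Π_μ θ(x_μ/(nK) − j_μ)` with r01's profile `θ` (`thetaProf`: `= 1` on `[−¾,¾]`, `= 0`
outside `]−⅞,⅞[`). [cite: Balaban1983RegularityDecay, §2 p. 575 «θ_j(x) = Π_μ θ((x_μ − Mj_μ)/M)»] -/
def thetaZ (n K : ℕ) (j : Fin (d + 1) → ℤ) (x : Fin (d + 1) → ℤ) : ℝ :=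
  thetaCube (K : ℝ) j (fun μ => ((x μ : ℤ) : ℝ) / n)

/-- `0 ≤ θ_j ≤ 1`. [cite: Balaban1983RegularityDecay, §2 p. 575] -/
theorem thetaZ_mem_Icc (n K : ℕ) (j : Fin (d + 1) → ℤ) (x : Fin (d + 1) → ℤ) :
    thetaZ n K j x ∈ Set.Icc (0 : ℝ) 1 :=
  thetaCube_mem_Icc _ _ _

/-- `|θ_j| ≤ 1`. [cite: Balaban1983RegularityDecay, §2 p. 575] -/
theorem abs_thetaZ_le_one (n K : ℕ) (j : Fin (d + 1) → ℤ) (x : Fin (d + 1) → ℤ) : |thetaZ n K j x| ≤ 1 := by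
  have h := thetaZ_mem_Icc n K j x
  rw [abs_of_nonneg h.1]
  exact h.2

/-- the scaled coordinate: `|x_μ/n − Kj_μ| = |x_μ − nKj_μ|/n`. [folklore] -/
private theorem abs_coord_fine {n : ℕ} (hn : 1 ≤ n) (K : ℕ) (a : ℤ) (b : ℤ) :
    |((a : ℤ) : ℝ) / n - (K : ℝ) * b| = |(a : ℝ) - (n : ℝ) * K * b| / n := by
  have hnr : (0 : ℝ) < n := by exact_mod_cast hn
  rw [eq_div_iff hnr.ne']
  nth_rewrite 2 [← abs_of_pos hnr]
  rw [← abs_mul]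
  congr 1
  field_simp

/-- **`θ_j = 1` ON THE CORE** «the cube {x: |x − Mj| ≤ ¾M}»: in fine-lattice units `4|x_μ − nKj_μ| ≤ 3nK` for all
`μ`. [cite: Balaban1983RegularityDecay, §2 p. 575] -/
theorem thetaZ_eq_one {n K : ℕ} (hn : 1 ≤ n) (hK : 1 ≤ K) {j x : Fin (d + 1) → ℤ}
    (h : ∀ μ, 4 * |((x μ : ℤ) : ℝ) - (n : ℝ) * K * j μ| ≤ 3 * ((n : ℝ) * K)) : thetaZ n K j x = 1 := by
  have hnr : (0 : ℝ) < n := by exact_mod_cast hn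
  have hKr : (0 : ℝ) < K := by exact_mod_cast hK
  refine thetaCube_eq_one hKr fun μ => ?_
  rw [abs_coord_fine hn K, div_le_iff₀ hnr]
  nlinarith [h μ]

/-- **`θ_j = 0` NEAR THE BOUNDARY OF `□_j`**: as soon as one coordinate has `8|x_μ − nKj_μ| ≥ 7nK`.
[cite: Balaban1983RegularityDecay, §2 p. 575] -/
theorem thetaZ_eq_zero {n K : ℕ} (hn : 1 ≤ n) (hK : 1 ≤ K) {j x : Fin (d + 1) → ℤ} {μ : Fin (d + 1)}
    (h : 7 * ((n : ℝ) * K) ≤ 8 * |((x μ : ℤ) : ℝ) - (n : ℝ) * K * j μ|) : thetaZ n K j x = 0 := by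
  have hnr : (0 : ℝ) < n := by exact_mod_cast hn
  have hKr : (0 : ℝ) < K := by exact_mod_cast hK
  refine thetaCube_eq_zero hKr (μ := μ) ?_
  rw [abs_coord_fine hn K, le_div_iff₀ hnr]
  nlinarith [h]

/-- the fine-lattice point `x + e_i` in scaled coordinates is the update of `x/n` at `i` by `1/n`. [folklore] -/
private theorem scaled_add_e1 (n : ℕ) (x : Fin (d + 1) → ℤ) (i : Fin (d + 1)) :
    (fun μ => (((x + e1 i) μ : ℤ) : ℝ) / n)
      = Function.update (fun μ => ((x μ : ℤ) : ℝ) / n) i (((x i : ℤ) : ℝ) / n + 1 / n) := by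
  funext μ
  by_cases hμ : μ = i
  · subst hμ
    rw [Function.update_self, Pi.add_apply, e1_apply_self]
    push_cast
    ring
  · rw [Function.update_of_ne hμ, Pi.add_apply, e1_apply_ne hμ, add_zero]

/-- **`|θ_j(x + e_μ) − θ_j(x)| ≤ D1(θ)/(nK)`**: one fine bond against a profile varying on the scale `nK` — the size
«with another constant c» of p. 575. [cite: Balaban1983RegularityDecay, §2 p. 575] -/
theorem abs_thetaZ_step_le {n K : ℕ} (hn : 1 ≤ n) (hK : 1 ≤ K) (j x : Fin (d + 1) → ℤ) (i : Fin (d + 1)) :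
    |thetaZ n K j (x + e1 i) - thetaZ n K j x| ≤ D1 thetaProf / ((n : ℝ) * K) := by
  have hnr : (0 : ℝ) < n := by exact_mod_cast hn
  have hKr : (0 : ℝ) < K := by exact_mod_cast hK
  unfold thetaZ
  rw [scaled_add_e1]
  have h := abs_thetaCube_diff_le hKr j (fun μ => ((x μ : ℤ) : ℝ) / n) i (1 / n)
  rw [abs_of_pos (by positivity : (0 : ℝ) < 1 / n)] at h
  refine h.trans (le_of_eq ?_)
  field_simp

end Theta

/-! ## §2. The fields `A′ = A − A₀`, `θ_jA′` and `Ã_j = A₀ + θ_jA′` on a region -/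

section Fields

variable (R : Finset (Fin (d + 1) → ℤ))

/-- **`A′ = A − A₀`** as a bond function on the region `R` (`A` in component form `Ac`, `A₀` a constant
configuration). [cite: Balaban1983RegularityDecay, §2 p. 575 «A = A₀ + A′»] -/
def fluct (A₀ : Fin (d + 1) → ℝ) (Ac : (Fin (d + 1) → ℤ) → Fin (d + 1) → ℝ) : ↥R → ↥R → ℝ :=
  fun x y => compField Ac x.1 y.1 - constBond A₀ Subtype.val x y

/-- **`θ_jA′`**, the cut-off fluctuation: `θ_j` is read at the lower end point `x ⊓ y` of the bond, so that on
`⟨x, x + e_μ⟩` the value is `θ_j(x)A′_μ(x)` (the print's component form) and the bond function is antisymmetric.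
[cite: Balaban1983RegularityDecay, §2 p. 575 «Ã_j = A₀ + θ_jA′»] -/
def cubeFluct (n K : ℕ) (j : Fin (d + 1) → ℤ) (A₀ : Fin (d + 1) → ℝ) (Ac : (Fin (d + 1) → ℤ) → Fin (d + 1) → ℝ) :
    ↥R → ↥R → ℝ :=
  fun x y => thetaZ n K j (x.1 ⊓ y.1) * fluct R A₀ Ac x y

/-- **`Ã_j = A₀ + θ_jA′`** — the cube configuration of p. 575. [cite: Balaban1983RegularityDecay, §2 p. 575] -/
def cubeField (n K : ℕ) (j : Fin (d + 1) → ℤ) (A₀ : Fin (d + 1) → ℝ) (Ac : (Fin (d + 1) → ℤ) → Fin (d + 1) → ℝ) :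
    ↥R → ↥R → ℝ :=
  constBond A₀ Subtype.val + cubeFluct R n K j A₀ Ac

variable {R}

/-- unfolding of `Ã_j` at a pair. [cite: Balaban1983RegularityDecay, §2 p. 575] -/
theorem cubeField_apply (n K : ℕ) (j : Fin (d + 1) → ℤ) (A₀ : Fin (d + 1) → ℝ)
    (Ac : (Fin (d + 1) → ℤ) → Fin (d + 1) → ℝ) (x y : ↥R) :
    cubeField R n K j A₀ Ac x y = constBond A₀ Subtype.val x y + cubeFluct R n K j A₀ Ac x y := rfl

/-- `A′` is antisymmetric. [cite: Balaban1983RegularityDecay, p. 576 «A_b̄ = −A_b»] -/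
theorem fluct_antisymm (A₀ : Fin (d + 1) → ℝ) (Ac : (Fin (d + 1) → ℤ) → Fin (d + 1) → ℝ) (x y : ↥R) :
    fluct R A₀ Ac y x = -fluct R A₀ Ac x y := by
  unfold fluct
  rw [compField_rev Ac x.1 y.1, constBond_antisymm A₀ Subtype.val x y]
  ring

/-- `θ_jA′` is antisymmetric. [cite: Balaban1983RegularityDecay, p. 576 «A_b̄ = −A_b»] -/
theorem cubeFluct_antisymm (n K : ℕ) (j : Fin (d + 1) → ℤ) (A₀ : Fin (d + 1) → ℝ)
    (Ac : (Fin (d + 1) → ℤ) → Fin (d + 1) → ℝ) (x y : ↥R) :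
    cubeFluct R n K j A₀ Ac y x = -cubeFluct R n K j A₀ Ac x y := by
  unfold cubeFluct
  rw [inf_comm, fluct_antisymm]
  ring

/-- `Ã_j` is antisymmetric. [cite: Balaban1983RegularityDecay, p. 576 «A_b̄ = −A_b»] -/
theorem cubeField_antisymm (n K : ℕ) (j : Fin (d + 1) → ℤ) (A₀ : Fin (d + 1) → ℝ)
    (Ac : (Fin (d + 1) → ℤ) → Fin (d + 1) → ℝ) (x y : ↥R) :
    cubeField R n K j A₀ Ac y x = -cubeField R n K j A₀ Ac x y := by
  rw [cubeField_apply, cubeField_apply, cubeFluct_antisymm, constBond_antisymm A₀ Subtype.val x y]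
  ring

/-- `e_μ ≥ 0` coordinatewise. [folklore] -/
private theorem e1_nonneg (μ : Fin (d + 1)) : (0 : Fin (d + 1) → ℤ) ≤ e1 μ := by
  intro i
  by_cases h : i = μ
  · subst h; rw [e1_apply_self]; exact zero_le_one
  · rw [e1_apply_ne h]; exact le_rfl

/-- the lower end point of the bond `⟨x, x + e_μ⟩` is `x`. [folklore] -/
private theorem inf_add_e1 (x : Fin (d + 1) → ℤ) (μ : Fin (d + 1)) : x ⊓ (x + e1 μ) = x :=
  inf_eq_left.2 (le_add_of_nonneg_right (e1_nonneg μ))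

/-- **THE BOND VALUE OF `A′`**: `A′_{⟨x, x+e_μ⟩} = A_μ(x) − A₀,μ`. [cite: Balaban1983RegularityDecay, §2 p. 575] -/
theorem fluct_step (A₀ : Fin (d + 1) → ℝ) (Ac : (Fin (d + 1) → ℤ) → Fin (d + 1) → ℝ) {x y : ↥R}
    {μ : Fin (d + 1)} (hy : y.1 = x.1 + e1 μ) : fluct R A₀ Ac x y = Ac x.1 μ - A₀ μ := by
  unfold fluct
  rw [constBond_step A₀ hy, hy, compField_add]

/-- **THE BOND VALUE OF `θ_jA′`**: `(θ_jA′)_{⟨x, x+e_μ⟩} = θ_j(x)(A_μ(x) − A₀,μ)` — the print's component form.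
[cite: Balaban1983RegularityDecay, §2 p. 575] -/
theorem cubeFluct_step (n K : ℕ) (j : Fin (d + 1) → ℤ) (A₀ : Fin (d + 1) → ℝ)
    (Ac : (Fin (d + 1) → ℤ) → Fin (d + 1) → ℝ) {x y : ↥R} {μ : Fin (d + 1)} (hy : y.1 = x.1 + e1 μ) :
    cubeFluct R n K j A₀ Ac x y = thetaZ n K j x.1 * (Ac x.1 μ - A₀ μ) := by
  unfold cubeFluct
  rw [fluct_step A₀ Ac hy, hy, inf_add_e1]

/-- **THE BOND VALUE OF `Ã_j`**: `(Ã_j)_{⟨x, x+e_μ⟩} = A₀,μ + θ_j(x)(A_μ(x) − A₀,μ)`.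
[cite: Balaban1983RegularityDecay, §2 p. 575] -/
theorem cubeField_step (n K : ℕ) (j : Fin (d + 1) → ℤ) (A₀ : Fin (d + 1) → ℝ)
    (Ac : (Fin (d + 1) → ℤ) → Fin (d + 1) → ℝ) {x y : ↥R} {μ : Fin (d + 1)} (hy : y.1 = x.1 + e1 μ) :
    cubeField R n K j A₀ Ac x y = A₀ μ + thetaZ n K j x.1 * (Ac x.1 μ - A₀ μ) := by
  rw [cubeField_apply, cubeFluct_step n K j A₀ Ac hy, constBond_step A₀ hy]

/-- `Ã_j = A` wherever `θ_j = 1` (at the lower end point). [cite: Balaban1983RegularityDecay, §2 p. 575] -/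
theorem cubeField_eq_compField_of_eq_one (n K : ℕ) (j : Fin (d + 1) → ℤ) (A₀ : Fin (d + 1) → ℝ)
    (Ac : (Fin (d + 1) → ℤ) → Fin (d + 1) → ℝ) {x y : ↥R} (h1 : thetaZ n K j (x.1 ⊓ y.1) = 1) :
    cubeField R n K j A₀ Ac x y = compField Ac x.1 y.1 := by
  rw [cubeField_apply]
  unfold cubeFluct fluct
  rw [h1]
  ring

/-- `Ã_j = A₀` wherever `θ_j = 0` (at the lower end point). [cite: Balaban1983RegularityDecay, §2 p. 575] -/
theorem cubeField_eq_constBond_of_eq_zero (n K : ℕ) (j : Fin (d + 1) → ℤ) (A₀ : Fin (d + 1) → ℝ)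
    (Ac : (Fin (d + 1) → ℤ) → Fin (d + 1) → ℝ) {x y : ↥R} (h0 : thetaZ n K j (x.1 ⊓ y.1) = 0) :
    cubeField R n K j A₀ Ac x y = constBond A₀ Subtype.val x y := by
  rw [cubeField_apply]
  unfold cubeFluct
  rw [h0, zero_mul, add_zero]

/-- the core is stable under `⊓`: `|min(a,b) − c| ≤ max(|a − c|, |b − c|)` in the form used below. [folklore] -/
private theorem abs_inf_sub_le {a b : ℤ} {c t : ℝ} (ha : 4 * |((a : ℤ) : ℝ) - c| ≤ t) (hb : 4 * |((b : ℤ) : ℝ) - c| ≤ t) :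
    4 * |(((a ⊓ b : ℤ)) : ℝ) - c| ≤ t := by
  rcases le_total a b with h | h
  · rw [inf_eq_left.2 h]; exact ha
  · rw [inf_eq_right.2 h]; exact hb

/-- **«we take Ã_j as equal to A on the cube {x: |x − Mj| ≤ ¾M}»**: for two sites of the ¾-core
(`4|x_μ − nKj_μ| ≤ 3nK` and the same for `y`, all `μ`), `Ã_j(x, y) = A(x, y)`.
[cite: Balaban1983RegularityDecay, §2 p. 575] -/
theorem cubeField_eq_compField {n K : ℕ} (hn : 1 ≤ n) (hK : 1 ≤ K) (j : Fin (d + 1) → ℤ) (A₀ : Fin (d + 1) → ℝ)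
    (Ac : (Fin (d + 1) → ℤ) → Fin (d + 1) → ℝ) {x y : ↥R}
    (hx : ∀ μ, 4 * |((x.1 μ : ℤ) : ℝ) - (n : ℝ) * K * j μ| ≤ 3 * ((n : ℝ) * K))
    (hy : ∀ μ, 4 * |((y.1 μ : ℤ) : ℝ) - (n : ℝ) * K * j μ| ≤ 3 * ((n : ℝ) * K)) :
    cubeField R n K j A₀ Ac x y = compField Ac x.1 y.1 := by
  refine cubeField_eq_compField_of_eq_one n K j A₀ Ac (thetaZ_eq_one hn hK fun μ => ?_)
  rw [Pi.inf_apply]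
  exact abs_inf_sub_le (hx μ) (hy μ)

/-- **«changing regularly to a constant function in a neighbourhood of a boundary of □_j»**: if the lower end point
of the pair has a coordinate with `8|x_μ − nKj_μ| ≥ 7nK`, then `Ã_j(x, y) = A₀(x, y)`.
[cite: Balaban1983RegularityDecay, §2 p. 575] -/
theorem cubeField_eq_constBond {n K : ℕ} (hn : 1 ≤ n) (hK : 1 ≤ K) (j : Fin (d + 1) → ℤ) (A₀ : Fin (d + 1) → ℝ)
    (Ac : (Fin (d + 1) → ℤ) → Fin (d + 1) → ℝ) {x y : ↥R} {μ : Fin (d + 1)}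
    (h : 7 * ((n : ℝ) * K) ≤ 8 * |(((x.1 ⊓ y.1) μ : ℤ) : ℝ) - (n : ℝ) * K * j μ|) :
    cubeField R n K j A₀ Ac x y = constBond A₀ Subtype.val x y :=
  cubeField_eq_constBond_of_eq_zero n K j A₀ Ac (thetaZ_eq_zero hn hK h)

end Fields

/-! ## §3. The sizes of `A′` and `θ_jA′` from the printed regularity (1.7) on a box -/

section Sizes

variable {N : Fin (d + 1) → ℕ}

/-- `0` is the base corner of the box `Π_μ[0, N_μ)` (`N_μ ≥ 1`). [folklore] -/
private theorem zero_mem_boxDom (hN : ∀ i, 1 ≤ N i) : (0 : Fin (d + 1) → ℤ) ∈ boxDom N :=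
  mem_boxDom.2 fun i => ⟨le_rfl, by have := hN i; simp only [Pi.zero_apply]; omega⟩

/-- **(1.7) ⇒ «A = A₀ + A′, |A′| ≤ c′e^{β−1}» ON A BOX BY TELESCOPING**: if `|A_ν(x + e_μ) − A_ν(x)| ≤ δ` for all
`x ∈ □ = Π_μ[0, N_μ)` and `N_μ ≤ T`, then `|A_ν(x) − A_ν(0)| ≤ (d+1)Tδ` for every `x ∈ □` (the staircase from the
corner to `x` has `≤ (d+1)T` steps inside `□`). [cite: Balaban1983RegularityDecay, §2 p. 575 «c′ = dMc»] -/
theorem abs_comp_sub_corner_le (hN : ∀ i, 1 ≤ N i) {T : ℤ} (hT : ∀ i, (N i : ℤ) ≤ T)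
    {Ac : (Fin (d + 1) → ℤ) → Fin (d + 1) → ℝ} {δ : ℝ} (hδ : 0 ≤ δ)
    (h17 : ∀ x ∈ boxDom N, ∀ μ ν : Fin (d + 1), |Ac (x + e1 μ) ν - Ac x ν| ≤ δ)
    {x : Fin (d + 1) → ℤ} (hx : x ∈ boxDom N) (ν : Fin (d + 1)) :
    |Ac x ν - Ac 0 ν| ≤ ((d : ℝ) + 1) * T * δ := by
  have h0 : (0 : Fin (d + 1) → ℤ) ∈ boxDom N := zero_mem_boxDom hN
  have hle : (0 : Fin (d + 1) → ℤ) ≤ x := fun i => (mem_boxDom.1 hx i).1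
  -- the staircase from the corner, its steps go up and stay in the box
  have hup : B4Lower18Regular.PathRel (fun u v : Fin (d + 1) → ℤ => ∃ μ, v = u + e1 μ) 0 (stair 0 x) :=
    pathRel_stairL_up x (List.finRange (d + 1)) 0
  have hmem : ∀ z ∈ stair 0 x, z ∈ boxDom N := fun z hz =>
    mem_boxDom_of_between h0 hx (mem_stair hle hz).1 (mem_stair hle hz).2
  have hpath := pathRel_chain (r := fun u v : Fin (d + 1) → ℤ => ∃ μ, v = u + e1 μ)
    (P := fun z => z ∈ boxDom N) _ _ h0 (pathRel_and _ _ hup hmem)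
  have hstep : ∀ p q : Fin (d + 1) → ℤ,
      (p ∈ boxDom N ∧ ((∃ μ, q = p + e1 μ) ∧ q ∈ boxDom N)) → |Ac q ν - Ac p ν| ≤ δ := by
    rintro p q ⟨hp, ⟨μ, rfl⟩, -⟩
    exact h17 p hp μ ν
  have htel := abs_sub_le_of_pathRel (f := fun p => Ac p ν) hstep _ _ hpath
  rw [pathEnd_stair hle] at htel
  have hlen : ((stair 0 x).length : ℝ) ≤ ((d : ℝ) + 1) * T := by
    have h := length_stair_le hle (K := T) fun j => by
      have := (mem_boxDom.1 hx j).2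
      have := hT j
      simp only [Pi.zero_apply]
      omega
    exact_mod_cast h
  exact htel.trans (mul_le_mul_of_nonneg_right hlen hδ)

/-- **`|A′_b| ≤ (d+1)Tδ`** on the nearest-neighbour bonds of the box (`A₀ = A(0)`).
[cite: Balaban1983RegularityDecay, §2 p. 575 «|A′| ≤ c′e^{β−1}»] -/
theorem abs_fluct_le (hN : ∀ i, 1 ≤ N i) {T : ℤ} (hT : ∀ i, (N i : ℤ) ≤ T)
    {Ac : (Fin (d + 1) → ℤ) → Fin (d + 1) → ℝ} {δ : ℝ} (hδ : 0 ≤ δ)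
    (h17 : ∀ x ∈ boxDom N, ∀ μ ν : Fin (d + 1), |Ac (x + e1 μ) ν - Ac x ν| ≤ δ)
    (x y : ↥(boxDom N)) (hxy : y.1 ∈ nbrs x.1) :
    |fluct (boxDom N) (Ac 0) Ac x y| ≤ ((d : ℝ) + 1) * T * δ := by
  obtain ⟨μ, h | h⟩ := mem_nbrs.1 hxy
  · have hy : y.1 = x.1 + e1 μ := h
    rw [fluct_step (Ac 0) Ac hy]
    exact abs_comp_sub_corner_le hN hT hδ h17 x.2 μ
  · have hx : x.1 = y.1 + e1 μ := by rw [h]; unfold e1; abel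
    rw [fluct_antisymm, abs_neg, fluct_step (Ac 0) Ac hx]
    exact abs_comp_sub_corner_le hN hT hδ h17 y.2 μ

/-- **`|θ_jA′_b| ≤ (d+1)Tδ`** on the nearest-neighbour bonds of the box. [cite: Balaban1983RegularityDecay, §2 p. 575] -/
theorem abs_cubeFluct_le (hN : ∀ i, 1 ≤ N i) {T : ℤ} (hT : ∀ i, (N i : ℤ) ≤ T)
    {Ac : (Fin (d + 1) → ℤ) → Fin (d + 1) → ℝ} {δ : ℝ} (hδ : 0 ≤ δ)
    (h17 : ∀ x ∈ boxDom N, ∀ μ ν : Fin (d + 1), |Ac (x + e1 μ) ν - Ac x ν| ≤ δ)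
    (n K : ℕ) (j : Fin (d + 1) → ℤ) (x y : ↥(boxDom N)) (hxy : y.1 ∈ nbrs x.1) :
    |cubeFluct (boxDom N) n K j (Ac 0) Ac x y| ≤ ((d : ℝ) + 1) * T * δ := by
  unfold cubeFluct
  rw [abs_mul]
  calc |thetaZ n K j (x.1 ⊓ y.1)| * |fluct (boxDom N) (Ac 0) Ac x y|
      ≤ 1 * (((d : ℝ) + 1) * T * δ) :=
        mul_le_mul (abs_thetaZ_le_one _ _ _ _) (abs_fluct_le hN hT hδ h17 x y hxy) (abs_nonneg _) zero_le_one
    _ = ((d : ℝ) + 1) * T * δ := one_mul _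

/-- **THE `|∂A′|`-MEMBER** («A′ is regular … Of course [Ã_j] satisfies the regularity condition with another
constant»): on two consecutive parallel bonds `b = ⟨x, z⟩`, `b′ = ⟨z, y⟩`, `z = x + e_μ`, `y = z + e_μ` of the box,
`|θ_jA′(b) − θ_jA′(b′)| ≤ δ(1 + D1(θ)(d+1)T/(nK))` — Leibniz: `(θ_j(x) − θ_j(z))A′_μ(x) + θ_j(z)(A_μ(x) − A_μ(z))`.
[cite: Balaban1983RegularityDecay, §2 p. 575 «|∂^η_μA′| ≤ c′e^{β−1}»] -/
theorem abs_cubeFluct_sub_le (hN : ∀ i, 1 ≤ N i) {T : ℤ} (hT : ∀ i, (N i : ℤ) ≤ T)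
    {Ac : (Fin (d + 1) → ℤ) → Fin (d + 1) → ℝ} {δ : ℝ} (hδ : 0 ≤ δ)
    (h17 : ∀ x ∈ boxDom N, ∀ μ ν : Fin (d + 1), |Ac (x + e1 μ) ν - Ac x ν| ≤ δ)
    {n K : ℕ} (hn : 1 ≤ n) (hK : 1 ≤ K) (j : Fin (d + 1) → ℤ) {x z y : ↥(boxDom N)} {μ : Fin (d + 1)}
    (hz : z.1 = x.1 + e1 μ) (hy : y.1 = z.1 + e1 μ) :
    |cubeFluct (boxDom N) n K j (Ac 0) Ac x z - cubeFluct (boxDom N) n K j (Ac 0) Ac z y|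
      ≤ δ * (1 + D1 thetaProf * (((d : ℝ) + 1) * T) / ((n : ℝ) * K)) := by
  rw [cubeFluct_step n K j (Ac 0) Ac hz, cubeFluct_step n K j (Ac 0) Ac hy]
  have hsplit : thetaZ n K j x.1 * (Ac x.1 μ - Ac 0 μ) - thetaZ n K j z.1 * (Ac z.1 μ - Ac 0 μ)
      = (thetaZ n K j x.1 - thetaZ n K j z.1) * (Ac x.1 μ - Ac 0 μ)
        + thetaZ n K j z.1 * (Ac x.1 μ - Ac z.1 μ) := by ring
  rw [hsplit]
  have hθ : |thetaZ n K j x.1 - thetaZ n K j z.1| ≤ D1 thetaProf / ((n : ℝ) * K) := by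
    rw [abs_sub_comm, hz]; exact abs_thetaZ_step_le hn hK j x.1 μ
  have hA : |Ac x.1 μ - Ac 0 μ| ≤ ((d : ℝ) + 1) * T * δ := abs_comp_sub_corner_le hN hT hδ h17 x.2 μ
  have hd : |Ac x.1 μ - Ac z.1 μ| ≤ δ := by
    rw [abs_sub_comm, hz]; exact h17 x.1 x.2 μ μ
  have hD : 0 ≤ D1 thetaProf := D1_nonneg contDiff_thetaProf hasCompactSupport_thetaProf
  calc |(thetaZ n K j x.1 - thetaZ n K j z.1) * (Ac x.1 μ - Ac 0 μ) + thetaZ n K j z.1 * (Ac x.1 μ - Ac z.1 μ)|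
      ≤ |(thetaZ n K j x.1 - thetaZ n K j z.1) * (Ac x.1 μ - Ac 0 μ)|
          + |thetaZ n K j z.1 * (Ac x.1 μ - Ac z.1 μ)| := abs_add_le _ _
    _ = |thetaZ n K j x.1 - thetaZ n K j z.1| * |Ac x.1 μ - Ac 0 μ|
          + |thetaZ n K j z.1| * |Ac x.1 μ - Ac z.1 μ| := by rw [abs_mul, abs_mul]
    _ ≤ D1 thetaProf / ((n : ℝ) * K) * (((d : ℝ) + 1) * T * δ) + 1 * δ :=
        add_le_add (mul_le_mul hθ hA (abs_nonneg _) (by positivity))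
          (mul_le_mul (abs_thetaZ_le_one _ _ _ _) hd (abs_nonneg _) zero_le_one)
    _ = δ * (1 + D1 thetaProf * (((d : ℝ) + 1) * T) / ((n : ℝ) * K)) := by ring

/-- the reversed-orientation member of the lineage's derivative hypothesis is the same quantity:
`θ_jA′(y,z) − θ_jA′(z,x) = θ_jA′(x,z) − θ_jA′(z,y)` (antisymmetry «A_b̄ = −A_b» of `θ_jA′`).
[cite: Balaban1983RegularityDecay, p. 576 «A_b̄ = −A_b» with §2 p. 575 (θ_jA′)] -/
theorem cubeFluct_sub_rev (n K : ℕ) (j : Fin (d + 1) → ℤ) (A₀ : Fin (d + 1) → ℝ)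
    (Ac : (Fin (d + 1) → ℤ) → Fin (d + 1) → ℝ) {R : Finset (Fin (d + 1) → ℤ)} (x z y : ↥R) :
    cubeFluct R n K j A₀ Ac y z - cubeFluct R n K j A₀ Ac z x
      = cubeFluct R n K j A₀ Ac x z - cubeFluct R n K j A₀ Ac z y := by
  rw [cubeFluct_antisymm n K j A₀ Ac z y, cubeFluct_antisymm n K j A₀ Ac x z]
  ring

/-- a box site whose backward `μ`-neighbour leaves the box sits on the low face: `x_μ = 0`. [folklore] -/
private theorem coord_eq_zero_of_sub_not_mem {x : Fin (d + 1) → ℤ} (hx : x ∈ boxDom N) {μ : Fin (d + 1)}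
    (h : x - e1 μ ∉ boxDom N) : x μ = 0 := by
  by_contra hne
  apply h
  rw [mem_boxDom] at hx ⊢
  intro i
  by_cases hi : i = μ
  · subst hi
    simp only [Pi.sub_apply, e1_apply_self]
    have := hx i
    omega
  · simp only [Pi.sub_apply, e1_apply_ne hi, sub_zero]
    exact hx i

/-- a box site `x` whose second forward `μ`-neighbour `x + 2e_μ` leaves the box sits next to the high face:
`x_μ + 2 ≥ N_μ`. [folklore] -/
private theorem coord_ge_of_add_add_not_mem {x : Fin (d + 1) → ℤ} (hx : x ∈ boxDom N) {μ : Fin (d + 1)}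
    (h : x + e1 μ + e1 μ ∉ boxDom N) : (N μ : ℤ) ≤ x μ + 2 := by
  by_contra hne
  apply h
  rw [mem_boxDom] at hx ⊢
  intro i
  by_cases hi : i = μ
  · subst hi
    simp only [Pi.add_apply, e1_apply_self]
    have := hx i
    omega
  · simp only [Pi.add_apply, e1_apply_ne hi, add_zero]
    exact hx i

/-- **`θ_j = 0` AT THE FACES OF `□_j`**: in the box `Π_μ[0, N_μ)` containing the cube (`nK(j_μ + 1) ≤ N_μ`,
`j_μ ≥ 1`, `nK ≥ 16`), a site with `x_μ = 0` or `x_μ + 2 ≥ N_μ` for some `μ` has `θ_j(x) = 0`.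
[cite: Balaban1983RegularityDecay, §2 p. 575 «constant … in a neighbourhood of a boundary of □_j»] -/
theorem thetaZ_eq_zero_of_face {n K : ℕ} (hn : 1 ≤ n) (hK : 1 ≤ K) (hnK : 16 ≤ n * K) {j : Fin (d + 1) → ℤ}
    (hjlo : ∀ μ, 1 ≤ j μ) (hjhi : ∀ μ, (n : ℤ) * K * (j μ + 1) ≤ N μ) {x : Fin (d + 1) → ℤ} {μ : Fin (d + 1)}
    (h : x μ = 0 ∨ (N μ : ℤ) ≤ x μ + 2) : thetaZ n K j x = 0 := by
  have hnKr : (16 : ℝ) ≤ (n : ℝ) * K := by exact_mod_cast hnK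
  have hj1 : (1 : ℝ) ≤ j μ := by exact_mod_cast hjlo μ
  refine thetaZ_eq_zero hn hK (μ := μ) ?_
  rcases h with h | h
  · rw [h, Int.cast_zero, zero_sub, abs_neg, abs_of_nonneg (by positivity)]
    nlinarith
  · have hhi : (n : ℝ) * K * (j μ + 1) ≤ (x μ : ℝ) + 2 := by
      have h' : (n : ℤ) * K * (j μ + 1) ≤ x μ + 2 := (hjhi μ).trans h
      exact_mod_cast h'
    rw [abs_of_nonneg (by nlinarith)]
    nlinarith

/-- **`θ_jA′ = 0` ON THE BONDS AT THE FACES** (the lineage's hypothesis «A′ = 0 on the bonds touching the faces»):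
for `y = x + e_μ` with `x − e_μ ∉ □` or `y + e_μ ∉ □`. [cite: Balaban1983RegularityDecay, §2 p. 575] -/
theorem cubeFluct_eq_zero_of_face {n K : ℕ} (hn : 1 ≤ n) (hK : 1 ≤ K) (hnK : 16 ≤ n * K) {j : Fin (d + 1) → ℤ}
    (hjlo : ∀ μ, 1 ≤ j μ) (hjhi : ∀ μ, (n : ℤ) * K * (j μ + 1) ≤ N μ) (A₀ : Fin (d + 1) → ℝ)
    (Ac : (Fin (d + 1) → ℤ) → Fin (d + 1) → ℝ) {x y : ↥(boxDom N)} {μ : Fin (d + 1)} (hy : y.1 = x.1 + e1 μ)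
    (hface : x.1 - e1 μ ∉ boxDom N ∨ y.1 + e1 μ ∉ boxDom N) :
    cubeFluct (boxDom N) n K j A₀ Ac x y = 0 ∧ cubeFluct (boxDom N) n K j A₀ Ac y x = 0 := by
  have hθ : thetaZ n K j x.1 = 0 := by
    refine thetaZ_eq_zero_of_face hn hK hnK hjlo hjhi (μ := μ) ?_
    rcases hface with h | h
    · exact Or.inl (coord_eq_zero_of_sub_not_mem x.2 h)
    · rw [hy] at h
      exact Or.inr (coord_ge_of_add_add_not_mem x.2 h)
  have h1 : cubeFluct (boxDom N) n K j A₀ Ac x y = 0 := by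
    unfold cubeFluct
    rw [hy, inf_add_e1, hθ, zero_mul]
  exact ⟨h1, by rw [cubeFluct_antisymm, h1, neg_zero]⟩

end Sizes

/-! ## §3b (v1.1). The component form of `Ã_j` and «it satisfies the regularity condition with another constant» -/

section Component

/-- **THE COMPONENT FORM OF `Ã_j`**: `(Ã_j)_ν(x) = A₀,ν + θ_j(x)(A_ν(x) − A₀,ν)` — the print's `Ã_j = A₀ + θ_jA′` as a
vector field in component form on `ℤ^{d+1}` (its bond function on a region is `cubeField`, `compField_cubeComp`).
[cite: Balaban1983RegularityDecay, §2 p. 575 «Ã_j = A₀ + θ_jA′»] -/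
def cubeComp (n K : ℕ) (j : Fin (d + 1) → ℤ) (A₀ : Fin (d + 1) → ℝ) (Ac : (Fin (d + 1) → ℤ) → Fin (d + 1) → ℝ) :
    (Fin (d + 1) → ℤ) → Fin (d + 1) → ℝ :=
  fun x ν => A₀ ν + thetaZ n K j x * (Ac x ν - A₀ ν)

/-- unfolding of the component form. [cite: Balaban1983RegularityDecay, §2 p. 575] -/
theorem cubeComp_apply (n K : ℕ) (j : Fin (d + 1) → ℤ) (A₀ : Fin (d + 1) → ℝ)
    (Ac : (Fin (d + 1) → ℤ) → Fin (d + 1) → ℝ) (x : Fin (d + 1) → ℤ) (ν : Fin (d + 1)) :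
    cubeComp n K j A₀ Ac x ν = A₀ ν + thetaZ n K j x * (Ac x ν - A₀ ν) := rfl

/-- the bond function of the component form IS `Ã_j`: on every nearest-neighbour pair of a region,
`compField (cubeComp …) x y = cubeField R … x y`. [cite: Balaban1983RegularityDecay, §2 p. 575 with p. 572
«A_{⟨x,x+ηe_μ⟩} = A_μ(x)»] -/
theorem compField_cubeComp {R : Finset (Fin (d + 1) → ℤ)} (n K : ℕ) (j : Fin (d + 1) → ℤ) (A₀ : Fin (d + 1) → ℝ)
    (Ac : (Fin (d + 1) → ℤ) → Fin (d + 1) → ℝ) (x y : ↥R) (hxy : y.1 ∈ nbrs x.1) :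
    compField (cubeComp n K j A₀ Ac) x.1 y.1 = cubeField R n K j A₀ Ac x y := by
  obtain ⟨μ, h | h⟩ := mem_nbrs.1 hxy
  · have hy : y.1 = x.1 + e1 μ := h
    rw [cubeField_step n K j A₀ Ac hy, hy, compField_add, cubeComp_apply]
  · have hx : x.1 = y.1 + e1 μ := by rw [h]; unfold e1; abel
    rw [compField_rev, cubeField_antisymm, hx, compField_add, cubeComp_apply,
      cubeField_step n K j A₀ Ac hx]

variable {N : Fin (d + 1) → ℕ}

/-- **«OF COURSE IT SATISFIES THE REGULARITY CONDITION (1.4) WITH ANOTHER CONSTANT c»**: if `A` satisfies (1.7) on the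
box `□ = Π_μ[0, N_μ)` (`N_μ ≤ T`) with bound `δ` on its forward differences, then `Ã_j` (component form, `A₀ = A(0)`)
satisfies it on the bonds of `□` with the bound `δ(1 + D1(θ)(d+1)T/(nK))` — EVERY pair of directions `(μ, ν)`,
transverse shifts included. [cite: Balaban1983RegularityDecay, §2 p. 575 with (1.7) p. 573] -/
theorem cubeComp_regular (hN : ∀ i, 1 ≤ N i) {T : ℤ} (hT : ∀ i, (N i : ℤ) ≤ T)
    {Ac : (Fin (d + 1) → ℤ) → Fin (d + 1) → ℝ} {δ : ℝ} (hδ : 0 ≤ δ)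
    (h17 : ∀ x ∈ boxDom N, ∀ μ ν : Fin (d + 1), |Ac (x + e1 μ) ν - Ac x ν| ≤ δ)
    {n K : ℕ} (hn : 1 ≤ n) (hK : 1 ≤ K) (j : Fin (d + 1) → ℤ) {x : Fin (d + 1) → ℤ} (hx : x ∈ boxDom N)
    {μ : Fin (d + 1)} (hxμ : x + e1 μ ∈ boxDom N) (ν : Fin (d + 1)) :
    |cubeComp n K j (Ac 0) Ac (x + e1 μ) ν - cubeComp n K j (Ac 0) Ac x ν|
      ≤ δ * (1 + D1 thetaProf * (((d : ℝ) + 1) * T) / ((n : ℝ) * K)) := by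
  rw [cubeComp_apply, cubeComp_apply]
  have hsplit : Ac 0 ν + thetaZ n K j (x + e1 μ) * (Ac (x + e1 μ) ν - Ac 0 ν)
      - (Ac 0 ν + thetaZ n K j x * (Ac x ν - Ac 0 ν))
      = (thetaZ n K j (x + e1 μ) - thetaZ n K j x) * (Ac (x + e1 μ) ν - Ac 0 ν)
        + thetaZ n K j x * (Ac (x + e1 μ) ν - Ac x ν) := by ring
  rw [hsplit]
  have hθ : |thetaZ n K j (x + e1 μ) - thetaZ n K j x| ≤ D1 thetaProf / ((n : ℝ) * K) :=
    abs_thetaZ_step_le hn hK j x μ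
  have hA : |Ac (x + e1 μ) ν - Ac 0 ν| ≤ ((d : ℝ) + 1) * T * δ := abs_comp_sub_corner_le hN hT hδ h17 hxμ ν
  have hd : |Ac (x + e1 μ) ν - Ac x ν| ≤ δ := h17 x hx μ ν
  have hD : 0 ≤ D1 thetaProf := D1_nonneg contDiff_thetaProf hasCompactSupport_thetaProf
  calc |(thetaZ n K j (x + e1 μ) - thetaZ n K j x) * (Ac (x + e1 μ) ν - Ac 0 ν)
        + thetaZ n K j x * (Ac (x + e1 μ) ν - Ac x ν)|
      ≤ |(thetaZ n K j (x + e1 μ) - thetaZ n K j x) * (Ac (x + e1 μ) ν - Ac 0 ν)|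
          + |thetaZ n K j x * (Ac (x + e1 μ) ν - Ac x ν)| := abs_add_le _ _
    _ = |thetaZ n K j (x + e1 μ) - thetaZ n K j x| * |Ac (x + e1 μ) ν - Ac 0 ν|
          + |thetaZ n K j x| * |Ac (x + e1 μ) ν - Ac x ν| := by rw [abs_mul, abs_mul]
    _ ≤ D1 thetaProf / ((n : ℝ) * K) * (((d : ℝ) + 1) * T * δ) + 1 * δ :=
        add_le_add (mul_le_mul hθ hA (abs_nonneg _) (by positivity))
          (mul_le_mul (abs_thetaZ_le_one _ _ _ _) hd (abs_nonneg _) zero_le_one)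
    _ = δ * (1 + D1 thetaProf * (((d : ℝ) + 1) * T) / ((n : ℝ) * K)) := by ring

end Component

end

end Literature.MathematicalPhysics.QuantumFieldTheory.Balaban1983to89.B4CubeFields22
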